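/-
Origin: expansion seat `prover-pub-hodgecm-mc-binder-2-g14-0`, handover #S6 2026-08-20T12:17Z md5 8cae49e50c4b (PKG 0c3c8fb1b38e → 8cae49e50c4b; 83 l.; σ implicit (`{σ}` after `jD`); `ins_mem_datumAt` over `datumAtσ … σ`; proof verbatim) (`HOME/mc/pub-hodgecm-mc-binder-2/g14/s5b/HodgeCM/Model/HypCensus/InsMemKInf.lean`, md5 8cae49e50c4b, 83 lines);
landed by the gen-20 packager (p-g20) in gate run 51 REPLACES the earlier landed copy of `HodgeCM/Model/HypCensus/InsMemKInf.lean` (seat copy carried the packager Origin header of an earlier run (stripped)).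
-/
/-
Origin: speedrun cell pub-hodgecm, MODEL-CONSTRUCTION sub-cell, lineage mc-binder-2 (BINDER-OWNERS rows 18/19: E binders
`hyp12` / `hyp34`), seat prover-pub-hodgecm-mc-binder-2-g12-0 (gen 12), 2026-08-20.
Target in PKG: `HodgeCM/Model/HypCensus/InsMemKInf.lean` (NEW additive leaf; imports this lineage's `HypCensus/KInfLetters` (gen 12) and
`HypCensus/InsMemDatumAt` (#49, RUN 40)).  KERNEL ONLY: 0 records, nothing cited as hypothesis, 0 `def … : Prop`.
-/
import Summits.HodgeConjecture.HodgeCM.Model.HypCensus.KInfLetters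
import Summits.HodgeConjecture.HodgeCM.Model.HypCensus.InsMemDatumAt

/-!
# Census kit (rows A12/A34), junction (J-x₀): `ins_mem` at the W pin OF RECORD, modulo ONE value identity

#49 `ins_mem_datumAt_of_letters` closes the census field `ins_mem` for the chosen place data from (c) a lettering `lett`/`hlett` of
`K_∞` and (e) the value identity `hκ` ((V-val)).  `HypCensus/KInfLetters` CONSTRUCTS (c) at the ball frame of record
`(τ, T, hT) := (ι₁, V.sylvesterFrame, sylvesterFrame_formCongr V)` (`KInfty V`).  This leaf plugs it in:

* **`ins_mem_datumAt`**: at `W₀ = wmInputCM₂g V S hGR η hη hηc ι₁ V.sylvesterFrame _`, under `hV : IsAnisotropic`, the sign fact `hW`,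
  and the ONE identity `hκ : ∀ k ∈ K_∞, η(frameG⁻¹ k frameG, 1) · pinLetterChar (letters k) · dVIota (lett k v₁) = κ(k)`,
  EVERY inserted printed vector `ins f φ` lies in `W₀.SK = 𝒮^κ`.

So for rows 18/19 the field `ins_mem` of `HypSideW` is CLOSED modulo the value-level identity (V-val) alone (E / glue-1: `η` is E's datum).
Nothing here is a claim of PerL/QW8.

**(T12)/(B1′) second table.** RULING S5b (B1′) re-base: the census datum is `datumAtσ V S jD (jIOf V S hW) σ` with the torus twist `σ` IMPLICIT (inferred from the printed
vector's type); `σ = 1` is the statement of record (`datumAt = datumAtσ 1` is an `abbrev`), so every consumer elaborates unchanged.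
-/

set_option autoImplicit false

noncomputable section

open NumberField NumberField.InfinitePlace
open scoped TensorProduct Classical
open Literature.NumberTheory.Automorphic Literature.NumberTheory.Automorphic.UnitaryGroup Literature.NumberTheory.Weil1964
open Literature.RepresentationTheory.KonnoKonno2007 Literature.RepresentationTheory.KonnoKonno2007.RealDualPair
open Literature.NumberTheory.GelbartRogawski1991 Literature.NumberTheory.GelbartRogawski1991.UnitaryDualPair
open Literature.Analysis.SegalBargmann
open HodgeCM HodgeCM.Model HodgeCM.Adelic
open HodgeCM.PerL34.Fock HodgeCM.PerL34.Fock.PrintDict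

namespace HodgeCM.Model.HypCensus

section Pin

variable {L : CMField} {ι₁ : L →+* ℂ} (V : HermSpace3 L ι₁) (S : StubTree.SeesawDatum L)
variable
  (hGR : (cmSplittingDatum (L : Type) finProdFinEquiv (frameD V) (frameD_real V) (frameD_ne V) (dW S) (dW_real S) (dW_ne S)).CompatibleSplitting)
  (η : CMAdelic (L : Type) (frameD V) × CMAdelic (L : Type) (dW S) →* ℂˣ)
  (hη : ∀ γU ∈ CMRat (L : Type) (frameD V), ∀ γ ∈ CMRat (L : Type) (dW S), η (γU, γ) = 1)
  (hηc : Continuous fun p => ((η p : ℂˣ) : ℂ))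
  (hV : IsAnisotropic L V.Hm)
  (hW : (∀ j, 0 < (ι₁ ((dW S) j)).re) ∨ ∀ j, (ι₁ ((dW S) j)).re < 0)
variable (jD : InfinitePlace (L : Type) → HodgeCM.PerL34.Fock.EqVar → Fin 6) (m₁ m₂ : InfinitePlace (L : Type) → ℤ)
variable {σ : InfinitePlace (L : Type) → Equiv.Perm (Fin 2)}
variable
  (hκ : ∀ k : ↥(KInfty V),
    ((η (kPair V S ι₁ V.sylvesterFrame (sylvesterFrame_formCongr V) k) : ℂˣ) : ℂ) *
        ((pinLetterChar V S hGR hW (kVLetters V S (lett V S k)) : Circle) : ℂ) * dVIota V S (lett V S k (cmPlace (L : Type) ι₁)) =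
      ((UnitaryGroup.archKappa (L : Type) V.Hm ι₁ V.sylvesterFrame (sylvesterFrame_formCongr V) k : ℂˣ) : ℂ))

include hV hκ in
/-- **THE CENSUS FIELD `ins_mem` AT THE W PIN OF RECORD, MODULO (V-val) ALONE** (rows 18/19, junction (J-x₀)): with the CONSTRUCTED
lettering `lett V S` of `K_∞` (`HypCensus/KInfLetters`), every inserted printed vector of the chosen place data lies in `𝒮^κ`. -/
theorem ins_mem_datumAt (f : FinSB ↥(maximalRealSubfield L) (Fin 6))
    (φ : (printPlaces (InfinitePlace (L : Type))
      (kindOf (L : Type) (frameD V) (frameD_real V) (dW S) (dW_real S) ι₁ (datumAtσ V S jD (jIOf V S hW) σ))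
      (lamOf (L : Type) (frameD V) (frameD_real V) (dW S) (dW_real S) ι₁ (datumAtσ V S jD (jIOf V S hW) σ))
      (lamOf_ne_zero (L : Type) (frameD V) (frameD_real V) (dW S) (dW_real S) ι₁ (datumAtσ V S jD (jIOf V S hW) σ))
      (pinnedVacs (kindOf (L : Type) (frameD V) (frameD_real V) (dW S) (dW_real S) ι₁ (datumAtσ V S jD (jIOf V S hW) σ)) m₁ m₂)).F) :
    ins (L : Type) (frameD V) (frameD_real V) (frameD_ne V) (dW S) (dW_real S) (dW_ne S) ι₁ (datumAtσ V S jD (jIOf V S hW) σ) m₁ m₂ f φ ∈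
      (wmInputCM₂g V S hGR η hη hηc ι₁ V.sylvesterFrame (sylvesterFrame_formCongr V)).SK :=
  ins_mem_datumAt_of_letters V S hGR η hη hηc ι₁ V.sylvesterFrame (sylvesterFrame_formCongr V) hV hW jD m₁ m₂ (lett V S)
    (letterSection_lett V S) hκ f φ

end Pin

end HodgeCM.Model.HypCensus

end
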